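import Mathlib.Analysis.Normed.Group.Basic
import HarnessLib

/-!
# NE7, ROAD P4 (law-level): NODE Q.old, item (k9) — the linear-algebra core of LEMMA FP of `PROOF-QV-NE7-P4.md`
# (positivity of the EXPONENTIALLY gauge-fixed one-step fluctuation form from positivity on an axial complement)

(Cell `pub-balaban`, sub-cell `t4`, binder row NE7 = node U5, co-owner #4 `b2b-balaban-t4-ne7-p4`, gen 3; skeleton
`HOME/t4/skeletons/NE7-t4-ne7-p4.md` v1.8 §2 NODE Q.old leaf (QV); proof file
`HOME/t4/b2b-balaban-t4-ne7-p4/g3/PROOF-QV-NE7-P4.md` v1 §4 Lemma FP; GAPS G-ne7p4-3 (UPDATE v1.8).)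

HONEST FRAMING (T4-DAG PAGE 1).  Rung (B)+1 on ONE FIXED finite four-torus, CONDITIONAL on `BetaPertH` and the nine
spine estimates (0/9 proved); NOT infinite volume, NOT a mass gap, NOT the Clay problem.  NE7 is NOT PRINTED and NOT
proved here.  This file is pure [folklore] normed-group arithmetic, sorry-free; it asserts NOTHING about Bałaban's
operators.  NOT summit progress.

WHAT THIS FILE DOES.  Lemma FP of the proof file derives the uniform lower bound `γ₀′` of the exponentially gauge-fixed
quadratic form `Q_{(1.5)} = Q_S + G^{(2)}` ([Balaban1987RG1] (1.5) p. 261) on the linearised constraint space from the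
AXIAL positivity hypothesis (H1) (= the sentence of [Balaban 1985, CMP 99:389] p. 428, cell F-T4-169 ∕ G-B9-09) by an
exact Faddeev–Popov decomposition `B′ = a′ + dλ` (a′ in the averaged-axial gauge): `Q_S(B′) = Q_S(a′)` (invariance of
the constrained Hessian at a critical-orbit point), `G^{(2)}(B′) = |λ|²` exactly, `|dλ|² ≤ 4d|λ|²`, and `Q_S(a′) ≥
(γ₀∕c₄²)|a′|²` after transferring (H1) from the tree-axial to the averaged-axial representative.  Everything specific to
Bałaban's objects is in those four identifications (DICTIONARY, not asserted here); what remains is the arithmetic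
below, over an arbitrary seminormed additive group `V` and arbitrary maps (linearity is not even needed):
* `le_of_invariant_transfer` — TRANSFER: if `q a′ = q (T a′)`, `γ·‖T a′‖² ≤ q (T a′)` and `‖a′‖ ≤ c·‖T a′‖`, then
  `(γ∕c²)·‖a′‖² ≤ q a′`;
* `gaugeFixed_lower_bound` — FP CORE: if `v = πa v + πg v`, `q v = q (πa v)`, `γ·‖πa v‖² ≤ q (πa v)`,
  `‖πg v‖² ≤ κ·p v`, then `(min γ κ⁻¹ ∕ 2)·‖v‖² ≤ q v + p v`;
* `gaugeFixed_lower_bound_pos` — the constant is positive when `γ, κ > 0`.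
-/

namespace Summit.QuantumFields.BalabanUV.T4Continuum.NE7LawLevel

section Transfer

variable {V W : Type*} [SeminormedAddCommGroup V] [SeminormedAddCommGroup W]

/-- **TRANSFER of a lower bound along an invariant re-gauging.**  If `q a = q′ (T a)` (DICTIONARY: `Q_S` takes the
same value on the averaged-axial representative `a` and on the tree-axial representative `T a` of the same gauge
class), `γ·‖T a‖² ≤ q′ (T a)` (the hypothesis (H1) on the tree-axial subspace) and `‖a‖ ≤ c·‖T a‖` with `0 < c`
(the re-gauging has bounded inverse), then `(γ / c²)·‖a‖² ≤ q a`. [folklore] -/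
theorem le_of_invariant_transfer (q : V → ℝ) (q' : W → ℝ) (T : V → W) {γ c : ℝ} (hγ : 0 ≤ γ) (hc : 0 < c)
    (hinv : ∀ a, q a = q' (T a)) (hpos : ∀ a, γ * ‖T a‖ ^ 2 ≤ q' (T a)) (hT : ∀ a, ‖a‖ ≤ c * ‖T a‖) (a : V) :
    γ / c ^ 2 * ‖a‖ ^ 2 ≤ q a := by
  rw [hinv a]
  refine le_trans ?_ (hpos a)
  have hc2 : 0 < c ^ 2 := by positivity
  have h1 : ‖a‖ ^ 2 ≤ (c * ‖T a‖) ^ 2 := pow_le_pow_left₀ (norm_nonneg a) (hT a) 2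
  calc γ / c ^ 2 * ‖a‖ ^ 2 ≤ γ / c ^ 2 * (c * ‖T a‖) ^ 2 :=
        mul_le_mul_of_nonneg_left h1 (div_nonneg hγ hc2.le)
    _ = γ * ‖T a‖ ^ 2 := by field_simp

end Transfer

section Core

variable {V : Type*} [SeminormedAddCommGroup V]

/-- **FP CORE (Lemma FP of `PROOF-QV-NE7-P4.md`, abstract form).**  Let every `v` split as `v = πa v + πg v`
(DICTIONARY: averaged-axial part `a′` and linearised gauge part `dλ`), let `q` be invariant under dropping the gauge
part (`q v = q (πa v)`: the constrained Hessian at a critical-orbit point), let `q` dominate `γ·‖·‖²` on the axial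
parts, and let the gauge-fixing term control the gauge part, `‖πg v‖² ≤ κ·p v` (DICTIONARY: `G^{(2)}(v) = |λ|²` and
`|dλ|² ≤ 4d·|λ|²`, so `κ = 4d`).  Then `(min γ κ⁻¹ / 2)·‖v‖² ≤ q v + p v` for every `v`. [folklore] -/
theorem gaugeFixed_lower_bound (q p : V → ℝ) (πa πg : V → V) {γ κ : ℝ} (hγ : 0 ≤ γ) (hκ : 0 < κ)
    (hsplit : ∀ v, πa v + πg v = v) (hinv : ∀ v, q v = q (πa v)) (hq : ∀ v, γ * ‖πa v‖ ^ 2 ≤ q (πa v))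
    (hp : ∀ v, ‖πg v‖ ^ 2 ≤ κ * p v) (v : V) : min γ κ⁻¹ / 2 * ‖v‖ ^ 2 ≤ q v + p v := by
  set m : ℝ := min γ κ⁻¹ with hm
  have hm0 : 0 ≤ m := le_min hγ (inv_nonneg.mpr hκ.le)
  have hmγ : m ≤ γ := min_le_left _ _
  have hmκ : m ≤ κ⁻¹ := min_le_right _ _
  -- ‖v‖² ≤ 2‖πa v‖² + 2‖πg v‖²
  have hv : ‖v‖ ^ 2 ≤ 2 * ‖πa v‖ ^ 2 + 2 * ‖πg v‖ ^ 2 := by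
    have h2 : ‖πa v + πg v‖ ^ 2 ≤ (‖πa v‖ + ‖πg v‖) ^ 2 :=
      pow_le_pow_left₀ (norm_nonneg _) (norm_add_le (πa v) (πg v)) 2
    rw [hsplit v] at h2
    nlinarith [sq_nonneg (‖πa v‖ - ‖πg v‖), h2]
  -- the gauge part: κ⁻¹‖πg v‖² ≤ p v
  have hg : κ⁻¹ * ‖πg v‖ ^ 2 ≤ p v := by
    rw [inv_mul_le_iff₀ hκ]
    exact hp v
  -- assemble
  have ha : m * ‖πa v‖ ^ 2 ≤ q (πa v) :=
    (mul_le_mul_of_nonneg_right hmγ (sq_nonneg _)).trans (hq v)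
  have hb : m * ‖πg v‖ ^ 2 ≤ p v :=
    (mul_le_mul_of_nonneg_right hmκ (sq_nonneg _)).trans hg
  rw [hinv v]
  calc m / 2 * ‖v‖ ^ 2 ≤ m / 2 * (2 * ‖πa v‖ ^ 2 + 2 * ‖πg v‖ ^ 2) :=
        mul_le_mul_of_nonneg_left hv (by positivity)
    _ = m * ‖πa v‖ ^ 2 + m * ‖πg v‖ ^ 2 := by ring
    _ ≤ q (πa v) + p v := add_le_add ha hb

/-- The FP constant is strictly positive when `γ, κ > 0` (in the application `γ = γ₀∕c₄²`, `κ = 4d`, and the bound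
is `γ₀′ = ½·min(γ₀∕c₄², 1∕(4d))`). [folklore] -/
theorem gaugeFixed_lower_bound_pos {γ κ : ℝ} (hγ : 0 < γ) (hκ : 0 < κ) : 0 < min γ κ⁻¹ / 2 :=
  div_pos (lt_min hγ (inv_pos.mpr hκ)) two_pos

/-- **LEMMA FP, assembled abstractly**: transfer + core.  With `T` the re-gauging of axial parts (bounded inverse
`‖a‖ ≤ c‖T a‖`), (H1) in the form `γ·‖T a‖² ≤ q′ (T a)`, invariance `q v = q (πa v) = q′ (T (πa v))`, and the
gauge-fixing control `‖πg v‖² ≤ κ·p v`: `(min (γ/c²) κ⁻¹ / 2)·‖v‖² ≤ q v + p v`. [folklore] -/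
theorem gaugeFixed_lower_bound_of_axial {W : Type*} [SeminormedAddCommGroup W] (q p : V → ℝ) (q' : W → ℝ)
    (πa πg : V → V) (T : V → W) {γ c κ : ℝ} (hγ : 0 ≤ γ) (hc : 0 < c) (hκ : 0 < κ)
    (hsplit : ∀ v, πa v + πg v = v) (hinv : ∀ v, q v = q (πa v)) (hinv' : ∀ a, q a = q' (T a))
    (hpos : ∀ a, γ * ‖T a‖ ^ 2 ≤ q' (T a)) (hT : ∀ a, ‖a‖ ≤ c * ‖T a‖) (hp : ∀ v, ‖πg v‖ ^ 2 ≤ κ * p v)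
    (v : V) : min (γ / c ^ 2) κ⁻¹ / 2 * ‖v‖ ^ 2 ≤ q v + p v :=
  gaugeFixed_lower_bound q p πa πg (div_nonneg hγ (by positivity)) hκ hsplit hinv
    (fun w => le_of_invariant_transfer q q' T hγ hc hinv' hpos hT (πa w)) hp v

end Core

end Summit.QuantumFields.BalabanUV.T4Continuum.NE7LawLevel
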